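import Mathlib
import HarnessLib
import HarnessLib.Audit
import Summits.QuantumFields.Statement
import HarnessLib.Audit.Status.Attr

/-!
Route: EquipartitionCriticality

DORMANT since 2026-08-23T07:37:30Z (reconciler: no traction for 6 d (last activity statement-grounded at 2026-08-17T07:34:13Z); parked, not closed — `ledger route dormant route-QuantumFields-EquipartitionCriticality --off` to reactivate) — unstaffed, not closed; items shared with open routes are served there. `ledger route dormant <id> --off` reactivates.

# Route EquipartitionCriticality — equipartition pins the free-gluon law, RP probes force ξ(β)→∞;
lattice YM reduces to gap-at-large-β plus the continuum limit at the β=∞ critical point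

It suffices to show X = X₁ ∧ X₂ ∧ X₃ ∧ X₄ for every compact simple G and every faithful unitary
lattice representation r (d = 4, Wilson action, torus states):
X₁ (FreeEnergyLogCoefficient) the free energy per site satisfies f_r(β) + (3·dim G/2) log β → K_r
(Chatterjee's theorem, transcribed from U(N) to simple G);
X₂ (EquipartitionPinsProbe, the card's device A) X₁ forces the β→∞ LOCAL law of every torus-limit
state to be the free-gluon (lattice-Maxwell ⊗ 𝔤) law, recorded through its
gauge-invariant shadow: the time-covariances of the β-rescaled one-plaquette probe φ(β(N − Re tr
r(U_p))) converge, uniformly over torus-limit states, to a positive,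
sub-exponentially decaying g(n); X₃ (LatticeGapLargeBeta) volume-uniform exponential clustering of
all gauge-invariant local observables at all sufficiently large β (Chatterjee 5.1(a)
at weak coupling, all-observable form; bulk first-order points at moderate β are deliberately
excluded); X₄ (CriticalContinuumLimit, restated 2026-08-16 for the Statement re-type p116790)
gap-at-large-β plus criticality (every admissible clustering rate m(β) → 0) yield a WEAK-COUPLING
scaling sequence (β_k = 2/g₀² → ∞, i.e. sch.HasWeakCouplingLimit — the β = ∞ critical point is the
only place this route ever takes the limit) and OS data with the
YangMills clauses. The support item RPProbeCriticality (device B: reflection positivity makes n ↦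
Cov(A, A∘τ_n) Hankel-positive, hence log-convex) turns X₂ into
criticality, so X₁ → X₂ → criticality is an unconditional proof of Chatterjee's Problem 5.1(b) and
the assembly is pure logic. Card realised: equipartition-pins-free-gluon-law (spine).
Lean: `FreeEnergyLogCoefficient ∧ EquipartitionPinsProbe ∧ LatticeGapLargeBeta ∧
CriticalContinuumLimit` (decls of this route; each body is a closed Prop over
Literature.MathematicalPhysics.QuantumFieldTheory.{IsCompactSimpleLieGroup, LatticeRep, YMSpecies,
latticeConnectedCorr, SpeciesScheme, OSData, IsYangMillsFor, HasLatticeMassGap} and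
Literature.MathematicalPhysics.QuantumLattice.{freeEnergyDensity, plaquetteObs, configShift,
infiniteVolumeLimitPoints}; rc 0 in Sketch.lean incl. `assembly_holds : Assembly`)

## Assembly
Pure logic (theorem `assembly_holds` in Sketch.lean, rc 0): fix G with its instances and hG :
IsCompactSimpleLieGroup G; FreeEnergyLogCoefficient gives the log-coefficient for every r;
EquipartitionPinsProbe turns it into the probe limit for every r; RPProbeCriticality turns that into
criticality for every r; LatticeGapLargeBeta gives the gap for every r; CriticalContinuumLimit
consumes both and returns the body of YangMills — including its first conjunct
sch.HasWeakCouplingLimit, produced inside the witness (re-type p116790; deciding theorem `closes`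
re-elaborated 2026-08-16) — under the same `letI := borel G` binders. The two clustering clauses
have matching shapes (the rate function of LatticeGapLargeBeta is admissible for the criticality
hypothesis; checked by an `example` in Sketch.lean).

Rationale: WHY THIS LINE. The one number Chatterjee's free-energy theorem delivers — the coefficient of log β,
an equipartition count of (d−1)·dim G Gaussian modes per site (arXiv160201222 Thm 2.1,
arXiv:2511.07297) — is, by convexity in β and Griffiths' lemma, an exact second-moment budget
β·E_μ[action per site] → 3 dim G/2 for EVERY torus-limit state; tightness, DLR
linearisation and the gradient-Gibbs structure of the massless Gaussian 2-form (Funaki–Spohn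
doi:10.1007/s002200050231, Georgii2011 Ch. 13; spin template arXiv:2212.06767 §5
Thm 30) leave only a random constant curvature c as ambiguity, and the budget (tilt costs |c|²/2)
kills it: the local β→∞ limit of non-abelian lattice Yang–Mills is the free
gluon law, with no expansion, no infrared bound (GiulianiOtt2025 needs Gaussian domination, false
here) and no renormalisation group. Reflection positivity
(OsterwalderSeiler1978, BorgsSeiler1983, FILS1978; tree TorusSiteRP/TorusOddRP, LatticeRP) then
converts order-zero local Gaussianity into an infrared statement: the
covariance sequence of a β-rescaled bounded probe is Hankel-positive, so a β-uniform clustering rate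
would force g(2t) ≤ e^(−2m(t−s)) g(2s) on its polynomially decaying limit —
impossible; hence every admissible lattice clustering rate tends to 0 (ξ(β) → ∞, Chatterjee
arXiv180301950 Problem 5.1(b), registered open in tree as the second conjunct of
LatticeMassGapAllCouplings) for every compact simple G. Imported areas: thermodynamic formalism /
variational principle (statistical mechanics), gradient Gibbs measures
(probability), RP moment sequences (constructive QFT). What it does that no prior route does: there
is no prior route on YangMills; against the sibling cards it is the
only line proving the infrared side from BELOW unconditionally, and it files the two honest
remaining cruxes (gap at all large β; continuum limit at the β = ∞ critical point)
in the volume-uniform, all-observable form the summit's HasLatticeMassGap consumes, so that gap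
engines (gronwall-gap-…, zero-free-…, ricci-heat-kernel-…,
finite-size-criterion-…) and continuum engines (parabolic-renormalised-trajectory, flow-first-…)
attach to shared declarations.

RANKED CRUXES. #2 FreeEnergyLogCoefficient (crux) — for every compact simple G and faithful unitary
lattice representation r, the torus free energy per site of 4-D Wilson lattice gauge theory
satisfies f_r(β) + (3 D/2) log β → K_r as β → ∞, where D = dim_ℝ of the Lie algebra {X : exp(tX) ∈
r(G) ∀t} of the closed subgroup r(G) ⊆ U(N) (= dim G). Card item K3; Chatterjee Thm 2.1 is the U(N)
case (D = N²); this is the unproved printed-type fact the mechanism rests on, hence ranked first.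
[difficulty: L] (why it might fail: Printed only for U(N): the Cayley-chart/Weyl-integration
small-ball Haar asymptotics (∏ j!/(2π)^(N/2)) and the axial-gauge large-field entropy count must be
redone for r(G) ⊂ U(N); the coefficient is a mode count and should survive, but no proof exists for
SU(N), SO(N), Sp(N), exceptional G.) [arXiv160201222, arXiv:2511.07297, SeilerLNP1982]
#3 EquipartitionPinsProbe (crux) — (card device A, gauge-invariant shadow) for every compact simple
G and faithful r: IF f_r(β) + (3D/2) log β converges THEN there are a bounded continuous φ : ℝ → ℝ
and g : ℕ → ℝ, with g(2s) > 0 and g(2s)·e^(−m(2t−2s)) < g(2t) for some s < t for every m > 0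
(sub-exponential decay), such that for every n the covariance of φ(β(N − Re tr r(U_p))) at the
origin plaquette in the (1,2) plane with its translate by n·e₀ converges to g(n) as β → ∞, uniformly
over all torus-limit states μ ∈ infiniteVolumeLimitPoints r.ρ β. Intended proof: Griffiths +
subgradient squeeze ⇒ β E_μ[action/site] → 3D/2; ½|√β ι(U_p)|² ≤ β(N − Re tr U_p) ⇒ tightness in a
rooted tree gauge per box; DLR linearisation ⇒ limit points Gibbs for the Gaussian closed-2-form
specification (d = 4 ≥ 3); stationary L² harmonic part = random constant c; budget 3D/2 ≥ 3D/2 +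
½E|c|² ⇒ c = 0 ⇒ unique limit law(Y), Y = dA lattice Maxwell ⊗ 𝔤; g(n) = Cov(φ(½|Y₀|²), φ(½|Y_n|²))
= ((1+λ/2)² − λ²c_n²)^(−D/2) − (1+λ/2)^(−D) for φ = e^(−λ·), c_n the Maxwell plaquette two-point
function along e₀ (c_n ≍ n⁻⁴, κ ≠ 0). [deps: FreeEnergyLogCoefficient] [difficulty: L] (why it might
fail: Gibbsianness of β→∞ local limit points for the linearised Gaussian 2-form specification needs
Feller-type equicontinuity of rescaled Wilson kernels on good boundary sets (unwritten for gauge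
fields); also needs c_n ≠ 0 for infinitely many even n (c_n ~ κn⁻⁴, κ ≠ 0: numerics only).)
[arXiv:2212.06767, doi:10.1007/s002200050231, Georgii2011, arXiv160201222, GarbanSepulveda2023]
#4 LatticeGapLargeBeta (crux) — (Chatterjee Problem 5.1(a) at weak coupling, volume-uniform
all-observable form) for every compact simple G and faithful r there are β₁, a rate function m(β) >
0 and a volume threshold S₀(β) (β ≥ β₁) such that for every pair A, B of bounded gauge-invariant
local lattice observables (YMSpecies) one constant C(A,B), uniform in β ≥ β₁, bounds the connected
time-correlation on every torus of side 2S+1 ≥ 2S₀(β)+1 at Wilson coupling β: |⟨A·τ_n B⟩ − ⟨A⟩⟨B⟩| ≤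
C e^(−m(β) n) for n ≤ S. Large β only: at an isolated first-order bulk point (SU(N), N ≥ 4,
fundamental Wilson action) the torus state is a phase mixture and does not cluster, and only β → ∞
is consumed downstream. Shared target for the gap engines of this sub-problem. [difficulty:
open-problem] (why it might fail: Open beyond strong coupling for every 4-D non-abelian theory
(OS78, SZZ23: small β only); FALSE for groups with a U(1) factor (Guth1980 Coulomb phase, barrier
AbelianDeconfinementD4), so a proof must use simplicity of G; β-uniform prefactors C(A,B) are an
extra spectral-weight demand.) [arXiv180301950, OsterwalderSeiler1978, arXiv220412737, Guth1980,
GlimmJaffe1987]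
#5 CriticalContinuumLimit (crux) — (scope crux: the continuum limit at the critical point β_c = ∞,
along a weak-coupling sequence; RESTATED 2026-08-16 for the Statement re-type p116790: the
∃-conclusion gains sch.HasWeakCouplingLimit, hypotheses unchanged) for every compact simple G: IF
every faithful r has the gap at all large β in the form of LatticeGapLargeBeta AND is critical at β
= ∞ in the form delivered by RPProbeCriticality (every admissible volume-uniform clustering rate
m(β), β-dependent constants allowed, tends to 0), THEN there are r, a sequential scheme (a_k → 0,
β_k → ∞ (sch.HasWeakCouplingLimit), L_k, renormalisations) and OS data T with IsYangMillsFor r sch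
T, non-trivial non-Gaussian curvature, and a mass gap Δ > 0 of the full Hamiltonian (T.HasMassGap Δ
∧ HasLatticeMassGap r sch Δ). Intended use: a_k := m(β_k)/Δ with β_k → ∞ (possible only because
m(β_k) → 0; β_k → ∞ is literally the new conjunct, so it costs nothing here), L_k ≥ S₀(β_k);
HasLatticeMassGap is then the hypothesis re-indexed; tightness/subsequences (ruling Y2) give T; E1
and non-Gaussianity at scale ξ are the open core. [deps: LatticeGapLargeBeta, RPProbeCriticality]
[difficulty: open-problem] (why it might fail: It is most of the Clay problem given criticality: OS
rotation invariance of subsequential limits, non-Gaussianity of tr F² at scale ξ(β) (φ⁴₄ is the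
trivial precedent, ADC 2021) and matching the plaquette clustering rate to the physical gap with
β-uniform spectral weights are all open.) [JaffeWitten2000, arXiv180301950, Balaban1988Convergent,
MagnenRivasseauSeneor1993, AizenmanDuminilCopinAnnals2021, MontvayMunster1994]
#9 RPProbeCriticality (support) — (card device B, known technique) for every compact simple G and
faithful r: the probe limit of EquipartitionPinsProbe implies that every admissible clustering rate
tends to zero: if m(β) > 0 for β ≥ β₁ and, for each such β, some S₀ and constants C(A,B,β) give
|corr_(β,2S+1)(A,B,n)| ≤ C e^(−m(β)n) for all YMSpecies A, B, S ≥ S₀, n ≤ S, then m(β) → 0 as β → ∞.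
Proof: pick a torus-limit state along odd tori at β (compactness), transfer the bound to c_β(n) =
Cov_μ(A_β, A_β∘τ_n) for the probe species A_β; site/mixed reflection positivity of Wilson torus
states (tree LatticeRP, TorusSiteRP, TorusOddRP; BorgsSeiler1983) makes (c_β(i+j)) Hankel-positive,
so a_n = c_β(2n) is non-negative and log-convex; LogConvexContraction gives c_β(2t) ≤
e^(−2m(β)(t−s)) c_β(2s); if m(β_j) ≥ m₀ along β_j → ∞ the probe limit gives g(2t) ≤ e^(−2m₀(t−s))
g(2s) for all s < t, contradicting the g-condition at m₀. [difficulty: M] [OsterwalderSeiler1978,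
BorgsSeiler1983, FILS1978, GlimmJaffe1987, SeilerLNP1982]
#9 LogConvexContraction (support) — a non-negative log-convex sequence (a_(n+1)² ≤ a_n a_(n+2))
dominated by C e^(−mn), m > 0, contracts stepwise: a_(n+1) ≤ e^(−m) a_n for all n (ratios
a_(k+1)/a_k are non-decreasing once positive; a ratio above e^(−m) would beat the exponential
bound). The sequence lemma behind "a uniform gap bounds the effective mass at every separation".
[difficulty: provable-now] [GlimmJaffe1987, SeilerLNP1982]
#9 SubgradientLogSqueeze (support) — if f(β) + c log β → K as β → ∞ then every subgradient p of f at
β (f(y) ≥ f(β) + p(y − β) for all y > 0) satisfies |β p + c| ≤ ε eventually in β, uniformly in p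
(difference quotients over [β, λβ] and [β/λ, β], λ ↓ 1). With Griffiths' lemma (torus-limit energy
densities are subgradients of the convex pressure) this is the equipartition step β·E_μ[action per
site] → 3D/2 of EquipartitionPinsProbe. [difficulty: provable-now] [Ruelle1969, Griffiths1966,
Georgii2011]

TWO-LAYER PLAN. Foreseen glued splits (nothing filed now): EquipartitionPinsProbe ⇐ Equipartition
(β·E_μ[action/site] → 3D/2 uniformly over torus-limit states; = FreeEnergyLogCoefficient +
Griffiths + SubgradientLogSqueeze) → LocalFreeGluonLaw (tree-gauge f.d.d. convergence to lattice
Maxwell ⊗ 𝔤, needs the definition curvatureGaussianField) → EquipartitionPinsProbe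
(identification of g, positivity via the 2×2 Gaussian determinant, c_n ≍ κn⁻⁴).
FreeEnergyLogCoefficient ⇐ lower bound (Gaussian/Jensen, easy) → upper bound (Chatterjee §§7–17
for r(G): small-ball Haar volume of r(G), axial-gauge entropy) → FreeEnergyLogCoefficient.
CriticalContinuumLimit ⇐ SchemeFromCriticality (a_k := m(β_k)/Δ along β_k → ∞ =
HasWeakCouplingLimit, HasLatticeMassGap
by re-indexing, tightness ⇒ subsequential T with E0, E2–E4) → RotationAndNonGaussianity (E1;
IsNontrivial ∧ IsNonGaussian of tr F² at scale ξ; cards running-gap-…,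
free-glue-cubically-…, sixteen-mirrors-…) → CriticalContinuumLimit. LatticeGapLargeBeta is left
whole for the gap engines (their routes attach by signature).

KILL CRITERIA. ¬EquipartitionPinsProbe with FreeEnergyLogCoefficient in hand — e.g. two torus-limit
states of SU(2)₄ whose rescaled probe covariances have different β→∞ limits, or a limit
with an atom (c ≠ 0) — closes the route `refuted:EquipartitionPinsProbe` (the pinning mechanism is
dead; maxwell-tangent-rigidity's Schwinger–Dyson kill would be the pivot).
¬FreeEnergyLogCoefficient for some simple G (coefficient ≠ 3 dim G/2) kills device A for that G:
pivot to U(N)-embedded groups only, route closes for the Clay ∀G form.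
¬LatticeGapLargeBeta (a massless or non-clustering phase of some 4-D simple-G Wilson theory at
arbitrarily large β, or failure of β-uniform prefactors) refutes the lattice leg of every route
through
HasLatticeMassGap with Wilson's action: close `refuted:LatticeGapLargeBeta` and hand the witness to
the negatives index. ¬CriticalContinuumLimit can only be refuted by a
triviality theorem for 4-D Yang–Mills (φ⁴₄-type) at weak coupling, which would bear on the conjunct
itself (a fixed-β pseudo-limit no longer counts: the restated conclusion demands β_k → ∞).
RPProbeCriticality and the two lemmas cannot fail (known mathematics); if
their Lean proofs stall the route is merely slow. YangMills proved elsewhere moots the route;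
Problem 5.1(b) proved elsewhere moots cruxes 2–3 but not the route.

NOT DECOMPOSED YET. The Equipartition/LocalFreeGluonLaw split of crux 3 (needs the definition of the
𝔤-valued lattice-Maxwell curvature field and a tree-gauge f.d.d. predicate); the
Gaussian-tail companion (card K1: P(|X_p| ≥ K) ≤ Ce^(−cK²) uniformly in β, needed only for UNBOUNDED
probes and the literal plaquette–plaquette ξ of Problem 5.1 — this
route uses bounded probes and does not file it); the lower/upper-bound split of crux 2; everything
inside crux 5 (scheme construction, OS axioms, non-Gaussianity, spectral
weights); the passage odd-torus RP → infinite-volume Hankel positivity inside the support item; d =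
3 and U(N)/SU(N)×U(1) variants (true but off-summit).

CHEAPEST FALSIFIER. (i) The log-β coefficient for SU(2), d = 4 must be −3·3/2 per site ⇔ per
plaquette β⟨2 − tr U_p⟩ → 3/4 in the tree's weight exp(−βΣ(N − Re tr U_p)), i.e. the textbook
β_W⟨1 − ½ tr U_p⟩ → 3/4 for S = β_W Σ(1 − ½ tr U_p) (weak-coupling equipartition; the card checked
the d = 2 one-plaquette case exactly: β_W⟨1−½trU_p⟩ → 3/2 at β_W = 1024 to 4 digits) — a standard 8⁴
SU(2) heat-bath run at β = 2.5–3 (kit, minutes) showing β_W⟨1−½trU_p⟩ and β_W²Cov(P₀,P_(2e₀))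
off the free-gluon values 3/4 and (3/2)c₂² would kill cruxes 2–3 at once. (ii) c_n =
Cov_Maxwell(F₁₂(0), F₁₂(n e₀)) = 0 for all large even n would void the g-condition:
the card's pure-python lattice sum gives n⁴c_n → 0.105 (d = 4), so no. (iii) Lookup: an RP lattice
gauge model with continuous compact G, free-gluon local limit and provably
β-bounded ξ would contradict RPProbeCriticality — none known (discrete G freeze instead, consistent
with ZnHiggsPhaseD4 / discrete-subgroup freezing). Not run this session (kit not in payload;
lean check of Sketch.lean rc 0 is the only computation performed).

NUMBERS. Coefficient c = (d−1)·dim G/2 per site: U(N): (d−1)N²/2 (Chatterjee Thm 2.1, d ≥ 2);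
SU(2)₄: 9/2; SU(3)₄: 12; per plaquette β⟨N − Re tr U_p⟩ → dim G/4 in d = 4 (six
plaquettes per site). Free curvature two-point function c_n = Cov(F₁₂(0),F₁₂(n e₀)): c₀ = 2/d = 1/2
(d = 4), c₁ ≈ 0.0689, n⁴c_n → 0.105 (card numerics, L = 32); g(n) ≈
(D/2)λ²c_n²(1+λ/2)^(−D−2) for φ = e^(−λ·). Strong-coupling rate m(β) ≥ −4 log(Cβ)
(OsterwalderSeiler1978). Items at open: 8 (4 cruxes, 3 support, 1 assembly); unchanged by the
2026-08-16 restatement of crux 5 (1:1, same decl name).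

DEFINITION REQUESTS. To be filed after open (none needed for the typed items): `repLieAlgebra (r :
LatticeRep G) : Submodule ℝ (Matrix (Fin r.N) (Fin r.N) ℂ)` := span{X | ∀ t, exp(tX) ∈
range r.ρ} with the lemma that it is the Lie algebra of r(G) and has finrank = dim G (topic
Literature/MathematicalPhysics/QuantumLattice, next to LatticeRep);
`curvatureGaussianField (d D : ℕ)` — the stationary centred Gaussian field of closed 𝔤 ≅ ℝ^D-valued
2-cochains on ℤ^d with the covariance of dA for the massless lattice
1-form, d ≥ 3 (topic Literature/MathematicalPhysics/QuantumFieldTheory, next to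
LatticeMaxwellGaussian/U1VillainMasslessPhotonD4) — needed for the layer-2 child
LocalFreeGluonLaw; `HasVolumeUniformClustering (r) (β m : ℝ) (S₀ : ℕ) : Prop` abbreviating the
clustering clause shared by cruxes 4, 5 and the support item (topic
Summits/QuantumFields/YangMills/Theorems). Cite-facts wanted: Funaki–Spohn uniqueness of
shift-invariant ergodic gradient Gibbs measures per tilt (doi:10.1007/s002200050231
Thm 2.1) in its Gaussian 2-form version; Borgs–Seiler mixed-plane RP (BorgsSeiler1983 §II.2) is
already mechanised in tree.

Novelty: Searches (2026-08-15, this seat; graph re-rank daemon resetting, run with --no-graph): `lit search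
--hybrid "spin wave Gaussian limit lattice gauge theory weak coupling infinite volume local
observables"` (12 textbooks: Creutz2022, MontvayMunster1994, Seiler-era proceedings — equipartition
as folklore, no theorem); `lit search --source crossref "weak coupling lattice gauge theory spin
wave Gaussian limit"` (10: Brihaye–Rossi NPB 1984 doi:10.1016/0550-3213(84)90099-3, Bartels–Wu PRD
1988/1990 semiclassical, Rathor 2026 PoS — physics, no infinite-volume theorem); `lit search
--source zbmath "lattice gauge weak coupling Gaussian"` (3, irrelevant); `lit galaxy search "spin
wave lattice gauge theory weak coupling" --star pdf` (0); `lit galaxy search "correlation length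
diverges lattice gauge theory continuum limit critical point beta to infinity" --star all` (0); `lit
frontier QuantumFields --since 2021` (30 rows; relevant arXiv:2401.10507 and arXiv:2603.24555 =
Chatterjee's GAUSSIAN scaling limits in Higgs regimes, arXiv:2606.19362 an RP-construction claim,
none on the pure-gauge local law or ξ→∞); openalex/S2 rate-limited (429); plus the card's own
searches and the mechanism critic's (hybrid ×3, arXiv ×3, crossref ×6, galaxy intelligent: 0
rigorous) of the same day; tree: LatticeMassGapAllCouplings/ChatterjeeMassGapProblem docstrings
("ξ(β)→∞ is not known for any 4-D non-abelian theory", audit 2026-08-15); negatives index empty.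
Nearest prior art found: arXiv:2212.06767 (Aru–Gar  [refs: 10.1016/0550-3213(84, 2401.10507, 2603.24555, 2606.19362, 2212.06767, 2302.07299, doi:10.1016/0550-3213, Creutz2022, MontvayMunster1994, Chatterjee2016, GiulianiOtt2025, GarbanSepulveda2023]

Barriers (technique_class: free-energy-equipartition, rp-spectral-probe): - technique_class: free-energy-equipartition, rp-spectral-probe
- Literature.Barriers.QuantumFields.PerturbativeInvisibility: outside its class — no series in g is
summed or truncated; cruxes 2–3 and the support item prove only what weak coupling CAN see (m(β) →
0, the free local law), never Δ > 0; the gap is isolated in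
LatticeGapLargeBeta/CriticalContinuumLimit where non-perturbative input is explicitly required.
- Literature.Barriers.QuantumFields.FixedCouplingUltralocality: this route is its recorded evasion
made a theorem-candidate: criticality (every admissible lattice rate → 0) is PROVED (cruxes 2–3 +
support), and CriticalContinuumLimit takes the scheme along β_k → ∞ with a_k := m(β_k)/Δ, never at
fixed coupling.
- Literature.Barriers.QuantumFields.AbelianDeconfinementD4: no conflict for cruxes 2–3 (their
conclusions are TRUE for U(1)₄/U(N)₄: ξ = ∞ in the Coulomb phase); it bites on LatticeGapLargeBeta,
which is false for groups with a U(1) factor — the crux is stated for compact SIMPLE G only and its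
why-it-might-fail line demands G-sensitive input; the bet is that the gap engines supply it.
- Literature.Barriers.QuantumFields.MigdalKadanoffGroupBlindness: not in the class (no approximate
decimation); same remark as above for crux 4.
- Literature.Barriers.QuantumFields.ZnHiggsPhaseD4: respected (discrete-subgroup freezing) —
everything is stated for compact simple (connected Lie) G; finite G has no √β scale and freezes with
a growing gap, consistent with RPProbeCriti

History (route lifecycle, newest last):
- 2026-08-16T17:42:47Z · rev 3: restated CriticalContinuumLimit (stmt-QuantumFields-8762) — route-repair (statement-revised p116790, unit rrepair-QuantumFields-EquipartitionCri-820e560b): `def YangMills` gained the first conjunct `sch.HasWeakCouplingLi (planner-rrepair-QuantumFields-EquipartitionCri-820e560b-0)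
- 2026-08-23T07:37:30Z · DORMANT — reconciler: no traction for 6 d (last activity statement-grounded at 2026-08-17T07:34:13Z); parked, not closed — `ledger route dormant route-QuantumFields-Equip (operator:999:3685284)

sub-problem: YangMills · status: dormant · opened planner-plancard-QuantumFields-YangMills-equi-272355b7-0 2026-08-15T13:30:37Z · rev 3 · ledger route-QuantumFields-EquipartitionCriticality
GENERATED by the gate from the ledger (D-0016/17). Provers cite these decls: `theorem foo : Summit.QuantumFields.YangMills.Theses.EquipartitionCriticality.<Decl> := …` in Summits/QuantumFields/YangMills/Theorems/<Name>.lean.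
-/

namespace Summit.QuantumFields.YangMills.Theses.EquipartitionCriticality

open scoped BigOperators Topology Manifold Classical MeasureTheory ProbabilityTheory Matrix InnerProductSpace ComplexConjugate ContinuousMap
open Filter Set Function TopologicalSpace MeasureTheory

attribute [summit_statement] _root_.YangMills

/-- item stmt-QuantumFields-8759 · crux · rank 2 · closed · proved by Summit.QuantumFields.YangMills.Theorems.freeEnergyLogCoefficient_proof @ c63cf0bd22ae (prover) · by planner
why it might fail: Printed for no G in scope: 1602.01222 Thm 2.1 (= 2511.07297 Thm 1) is U(N) on free boxes; its §6 small-ball law (Weyl density, GUE) and §11 spectral chart are U(N)-specific and need exponential-chart versions on r(G); as typed f_r is the TORUS density, so torus-vs-box independence is owed too.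
sources: arXiv160201222, arXiv:2511.07297, FriedliVelenik2017, SeilerLNP1982, Literature.MathematicalPhysics.QuantumLattice.exists_hasFreeEnergyDensity_holds
[crux] for every compact simple G and faithful unitary lattice representation r, the torus free
energy per site of 4-D Wilson lattice gauge theory satisfies f_r(β) + (3 D/2) log β → K_r as β → ∞,
where D = dim_ℝ of the Lie algebra {X : exp(tX) ∈ r(G) ∀t} of the closed subgroup r(G) ⊆ U(N) (= dim
G). Card item K3; Chatterjee Thm 2.1 is the U(N) case (D = N²); this is the unproved printed-type
fact the mechanism rests on, hence ranked first. [difficulty: L] -/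
@[route_item "route-QuantumFields-EquipartitionCriticality", crux]
def FreeEnergyLogCoefficient : Prop :=
  ∀ (G : Type) [Group G] [TopologicalSpace G] [IsTopologicalGroup G] [CompactSpace G], Literature.MathematicalPhysics.QuantumFieldTheory.IsCompactSimpleLieGroup G → letI : MeasurableSpace G := borel G; haveI : BorelSpace G := ⟨rfl⟩; ∀ r : Literature.MathematicalPhysics.QuantumFieldTheory.LatticeRep G, ∃ K : ℝ, Filter.Tendsto (fun β : ℝ => Literature.MathematicalPhysics.QuantumLattice.freeEnergyDensity 4 r.ρ β + (3 * (Module.finrank ℝ ↥(Submodule.span ℝ {X : Matrix (Fin r.N) (Fin r.N) ℂ | ∀ t : ℝ, NormedSpace.exp ((t : ℂ) • X) ∈ Set.range r.ρ}) : ℝ) / 2) * Real.log β) Filter.atTop (nhds K)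

/-- item stmt-QuantumFields-8760 · crux · rank 3 · closed · proved by Summit.QuantumFields.YangMills.Theorems.EquipartitionPinsProbe_proof @ 513bff35494d (prover) · by planner
why it might fail: Unwritten: (i) β→∞ local limits Gibbs for the 𝔤⊗Maxwell Gaussian specification (Feller equicontinuity of rescaled Wilson kernels; spin precedent only, 2212.06767 Thm 30); (ii) harmonic part of the gauge-degenerate form = E[Y|tail] = const (Georgii Ch.13); (iii) c_2n ≠ 0 i.o. (κ = 1/π²; lattice owed)
sources: arXiv:2212.06767, doi:10.1007/s002200050231, Georgii2011, arXiv160201222, GarbanSepulveda2023, LawlerLimic2010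
[crux] (card device A, gauge-invariant shadow) for every compact simple G and faithful r: IF f_r(β)
+ (3D/2) log β converges THEN there are a bounded continuous φ : ℝ → ℝ and g : ℕ → ℝ, with g(2s) > 0
and g(2s)·e^(−m(2t−2s)) < g(2t) for some s < t for every m > 0 (sub-exponential decay), such that
for every n the covariance of φ(β(N − Re tr r(U_p))) at the origin plaquette in the (1,2) plane with
its translate by n·e₀ converges to g(n) as β → ∞, uniformly over all torus-limit states μ ∈
infiniteVolumeLimitPoints r.ρ β. Intended proof: Griffiths + subgradient squeeze ⇒ β
E_μ[action/site] → 3D/2; ½|√β ι(U_p)|² ≤ β(N − Re tr U_p) ⇒ tightness in a rooted tree gauge per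
box; DLR linearisation ⇒ limit points Gibbs for the Gaussian closed-2-form specification (d = 4 ≥
3); stationary L² harmonic part = random constant c; budget 3D/2 ≥ 3D/2 + ½E|c|² ⇒ c = 0 ⇒ unique
limit law(Y), Y = dA lattice Maxwell ⊗ 𝔤; g(n) = Cov(φ(½|Y₀|²), φ(½|Y_n|²)) = ((1+λ/2)² −
λ²c_n²)^(−D/2) − (1+λ/2)^(−D) for φ = e^(−λ·), c_n the Maxwell plaquette two-point function along e₀
(c_n ≍ n⁻⁴, κ ≠ 0). [deps: FreeEnergyLogCoefficient] [difficulty: L] -/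
@[route_item "route-QuantumFields-EquipartitionCriticality", crux]
def EquipartitionPinsProbe : Prop :=
  ∀ (G : Type) [Group G] [TopologicalSpace G] [IsTopologicalGroup G] [CompactSpace G], Literature.MathematicalPhysics.QuantumFieldTheory.IsCompactSimpleLieGroup G → letI : MeasurableSpace G := borel G; haveI : BorelSpace G := ⟨rfl⟩; ∀ r : Literature.MathematicalPhysics.QuantumFieldTheory.LatticeRep G, (∃ K : ℝ, Filter.Tendsto (fun β : ℝ => Literature.MathematicalPhysics.QuantumLattice.freeEnergyDensity 4 r.ρ β + (3 * (Module.finrank ℝ ↥(Submodule.span ℝ {X : Matrix (Fin r.N) (Fin r.N) ℂ | ∀ t : ℝ, NormedSpace.exp ((t : ℂ) • X) ∈ Set.range r.ρ}) : ℝ) / 2) * Real.log β) Filter.atTop (nhds K)) → ∃ φ : ℝ → ℝ, Continuous φ ∧ (∃ C : ℝ, ∀ x, |φ x| ≤ C) ∧ ∃ g : ℕ → ℝ, (∀ m : ℝ, 0 < m → ∃ s t : ℕ, s < t ∧ 0 < g (2 * s) ∧ g (2 * s) * Real.exp (-(m * (2 * (t : ℝ) - 2 * (s : ℝ)))) < g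 (2 * t)) ∧ ∀ (n : ℕ) (ε : ℝ), 0 < ε → ∀ᶠ β : ℝ in Filter.atTop, ∀ μ ∈ Literature.MathematicalPhysics.QuantumLattice.infiniteVolumeLimitPoints (d := 4) r.ρ β, |(∫ U, φ (β * ((r.N : ℝ) - Literature.MathematicalPhysics.QuantumLattice.plaquetteObs r.ρ 0 1 2 U)) * φ (β * ((r.N : ℝ) - Literature.MathematicalPhysics.QuantumLattice.plaquetteObs r.ρ 0 1 2 (Literature.MathematicalPhysics.QuantumLattice.configShift (-(Pi.single 0 (n : ℤ))) U))) ∂μ) - (∫ U, φ (β * ((r.N : ℝ) - Literature.MathematicalPhysics.QuantumLattice.plaquetteObs r.ρ 0 1 2 U)) ∂μ) * (∫ U, φ (β * ((r.N : ℝ) - Literature.MathematicalPhysics.QuantumLattice.plaquetteObs r.ρ 0 1 2 (Literature.MathematicalPhysics.QuantumLattice.configShift (-(Pi.single 0 (n : ℤ))) U))) ∂μ) - g n| < ε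

/-- item stmt-QuantumFields-8761 · crux · rank 4 · open · by planner
why it might fail: It IS the 4-D lattice gap: clustering proved only at strong coupling (OS78 §4, SZZ23), at large β for no non-abelian G (1803.01950 §6); FALSE with a U(1) factor (Guth 1980, Fröhlich–Spencer; tree AbelianDeconfinementD4), so simplicity must enter; β-uniform C(A,B) is an extra spectral-weight demand.
sources: arXiv180301950, OsterwalderSeiler1978, arXiv220412737, Guth1980, FrohlichSpencerCMP1982, Literature.Barriers.QuantumFields.AbelianDeconfinementD4
[crux] (Chatterjee Problem 5.1(a) at weak coupling, volume-uniform all-observable form) for every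
compact simple G and faithful r there are β₁, a rate function m(β) > 0 and a volume threshold S₀(β)
(β ≥ β₁) such that for every pair A, B of bounded gauge-invariant local lattice observables
(YMSpecies) one constant C(A,B), uniform in β ≥ β₁, bounds the connected time-correlation on every
torus of side 2S+1 ≥ 2S₀(β)+1 at Wilson coupling β: |⟨A·τ_n B⟩ − ⟨A⟩⟨B⟩| ≤ C e^(−m(β) n) for n ≤ S.
Large β only: at an isolated first-order bulk point (SU(N), N ≥ 4, fundamental Wilson action) the
torus state is a phase mixture and does not cluster, and only β → ∞ is consumed downstream. Shared
target for the gap engines of this sub-problem. [difficulty: open-problem] -/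
@[route_item "route-QuantumFields-EquipartitionCriticality", crux]
def LatticeGapLargeBeta : Prop :=
  ∀ (G : Type) [Group G] [TopologicalSpace G] [IsTopologicalGroup G] [CompactSpace G], Literature.MathematicalPhysics.QuantumFieldTheory.IsCompactSimpleLieGroup G → letI : MeasurableSpace G := borel G; haveI : BorelSpace G := ⟨rfl⟩; ∀ r : Literature.MathematicalPhysics.QuantumFieldTheory.LatticeRep G, ∃ (β₁ : ℝ) (m : ℝ → ℝ) (S₀ : ℝ → ℕ), (∀ β : ℝ, β₁ ≤ β → 0 < m β) ∧ ∀ A B : Literature.MathematicalPhysics.QuantumFieldTheory.YMSpecies G, ∃ C : ℝ, ∀ β : ℝ, β₁ ≤ β → ∀ S n : ℕ, S₀ β ≤ S → n ≤ S → |Literature.MathematicalPhysics.QuantumFieldTheory.latticeConnectedCorr r.ρ β (2 * S + 1) A.F B.F n| ≤ C * Real.exp (-(m β * n))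

-- earlier CriticalContinuumLimit (stmt-QuantumFields-8762, replaced 2026-08-16T17:42:47Z -> stmt-QuantumFields-15940): moot by None — ∀ (G : Type) [Group G] [TopologicalSpace G] [IsTopologicalGroup G] [CompactSpace G], Literature.MathematicalPhysics.QuantumFieldTheory.IsCompactSimpleLieGroup G → letI : MeasurableSpace G := borel G; haveI : BorelSpace G := ⟨rfl⟩; (∀ r : Literature.MathematicalPhysics
/-- item stmt-QuantumFields-15940 · crux · rank 5 · open · by planner
why it might fail: Given gap + criticality it is still most of Clay: E1 (O(4)) of subsequential limits, non-Gaussianity of tr F² at scale ξ(β) (φ⁴₄ IS Gaussian: ADC 2021, ScalarPhi4Triviality), T.HasMassGap for ALL species from plaquette clustering; only β_k → ∞ is free (criticality), nothing else is.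
sources: JaffeWitten2000, arXiv180301950, Balaban1988Convergent, MagnenRivasseauSeneor1993, AizenmanDuminilCopinAnnals2021, Literature.Barriers.QuantumFields.ScalarPhi4Triviality
[crux] (scope crux, RE-TYPED after statement revision p116790 — the continuum limit at the critical
point β_c = ∞ is taken at WEAK COUPLING) for every compact simple G: IF every faithful r has the gap
at all large β in the form of LatticeGapLargeBeta AND is critical at β = ∞ (every admissible
volume-uniform clustering rate m(β), β-dependent constants allowed, tends to 0 — supplied here by
CriticalityOfXiDiverges, in route EquipartitionCriticality by RPProbeCriticality), THEN there are r,
a sequential scheme sch with β_k → ∞ (`sch.HasWeakCouplingLimit`), a_k → 0, L_k, renormalisations,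
and OS data T with IsYangMillsFor r sch T, non-trivial non-Gaussian curvature, and a mass gap Δ > 0
of the full Hamiltonian (T.HasMassGap Δ ∧ HasLatticeMassGap r sch Δ) — literally the ∃-body of the
re-typed `YangMills` under its own `letI := borel G` binders. Supersedes CriticalContinuumLimit
(stmt-QuantumFields-8762: same hypotheses, conclusion without the weak-coupling conjunct) for this
route; the intended witness is unchanged and already weak-coupling: choose ANY β_k → ∞, put a_k :=
m(β_k)/Δ → 0 (possible only because m(β_k) → 0 by criticality), L_k ≥ S₀(β_k) with a_k L_k → ∞; then
HasWeakCouplin -/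
@[route_item "route-QuantumFields-EquipartitionCriticality", crux]
def CriticalContinuumLimit : Prop :=
  ∀ (G : Type) [Group G] [TopologicalSpace G] [IsTopologicalGroup G] [CompactSpace G], Literature.MathematicalPhysics.QuantumFieldTheory.IsCompactSimpleLieGroup G → letI : MeasurableSpace G := borel G; haveI : BorelSpace G := ⟨rfl⟩; (∀ r : Literature.MathematicalPhysics.QuantumFieldTheory.LatticeRep G, ∃ (β₁ : ℝ) (m : ℝ → ℝ) (S₀ : ℝ → ℕ), (∀ β : ℝ, β₁ ≤ β → 0 < m β) ∧ ∀ A B : Literature.MathematicalPhysics.QuantumFieldTheory.YMSpecies G, ∃ C : ℝ, ∀ β : ℝ, β₁ ≤ β → ∀ S n : ℕ, S₀ β ≤ S → n ≤ S → |Literature.MathematicalPhysics.QuantumFieldTheory.latticeConnectedCorr r.ρ β (2 * S + 1) A.F B.F n| ≤ C * Real.exp (-(m β * n))) → (∀ r : Literature.MathematicalPhysics.QuantumFieldTheory.LatticeRep G, ∀ (β₁ : ℝ) (m : ℝ → ℝ), (∀ β : ℝ, β₁ ≤ β → 0 < m β ∧ (∃ S₀ : ℕ, ∀ A B : Literature.MathematicalPhysics.QuantumFieldTheory.YMSpecies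 G, ∃ C : ℝ, ∀ S n : ℕ, S₀ ≤ S → n ≤ S → |Literature.MathematicalPhysics.QuantumFieldTheory.latticeConnectedCorr r.ρ β (2 * S + 1) A.F B.F n| ≤ C * Real.exp (-(m β * n)))) → ∀ m₀ : ℝ, 0 < m₀ → ∀ᶠ β : ℝ in Filter.atTop, m β < m₀) → ∃ (r : Literature.MathematicalPhysics.QuantumFieldTheory.LatticeRep G) (sch : Literature.MathematicalPhysics.QuantumFieldTheory.SpeciesScheme (Literature.MathematicalPhysics.QuantumFieldTheory.YMSpecies G)) (T : Literature.MathematicalPhysics.QuantumFieldTheory.OSData (Literature.MathematicalPhysics.QuantumFieldTheory.YMSpecies G) 4), sch.HasWeakCouplingLimit ∧ Literature.MathematicalPhysics.QuantumFieldTheory.IsYangMillsFor r sch T ∧ T.IsNontrivial r.curvature ∧ T.IsNonGaussian r.curvature ∧ ∃ Δ > 0, T.HasMassGap Δ ∧ Literature.MathematicalPhysics.QuantumFieldTheory.HasLatticeMassGap r sch Δ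

/-- item stmt-QuantumFields-8763 · support · rank 9 · closed · proved by Summit.QuantumFields.YangMills.Theorems.rpProbeCriticality_proof (prover) · by planner
sources: OsterwalderSeiler1978, BorgsSeiler1983, FILS1978, GlimmJaffe1987, SeilerLNP1982
[support] (card device B, known technique) for every compact simple G and faithful r: the probe
limit of EquipartitionPinsProbe implies that every admissible clustering rate tends to zero: if m(β)
> 0 for β ≥ β₁ and, for each such β, some S₀ and constants C(A,B,β) give |corr_(β,2S+1)(A,B,n)| ≤ C
e^(−m(β)n) for all YMSpecies A, B, S ≥ S₀, n ≤ S, then m(β) → 0 as β → ∞. Proof: pick a torus-limit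
state along odd tori at β (compactness), transfer the bound to c_β(n) = Cov_μ(A_β, A_β∘τ_n) for the
probe species A_β; site/mixed reflection positivity of Wilson torus states (tree LatticeRP,
TorusSiteRP, TorusOddRP; BorgsSeiler1983) makes (c_β(i+j)) Hankel-positive, so a_n = c_β(2n) is
non-negative and log-convex; LogConvexContraction gives c_β(2t) ≤ e^(−2m(β)(t−s)) c_β(2s); if m(β_j)
≥ m₀ along β_j → ∞ the probe limit gives g(2t) ≤ e^(−2m₀(t−s)) g(2s) for all s < t, contradicting
the g-condition at m₀. [difficulty: M] -/
@[route_item "route-QuantumFields-EquipartitionCriticality", crux]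
def RPProbeCriticality : Prop :=
  ∀ (G : Type) [Group G] [TopologicalSpace G] [IsTopologicalGroup G] [CompactSpace G], Literature.MathematicalPhysics.QuantumFieldTheory.IsCompactSimpleLieGroup G → letI : MeasurableSpace G := borel G; haveI : BorelSpace G := ⟨rfl⟩; ∀ r : Literature.MathematicalPhysics.QuantumFieldTheory.LatticeRep G, (∃ φ : ℝ → ℝ, Continuous φ ∧ (∃ C : ℝ, ∀ x, |φ x| ≤ C) ∧ ∃ g : ℕ → ℝ, (∀ m : ℝ, 0 < m → ∃ s t : ℕ, s < t ∧ 0 < g (2 * s) ∧ g (2 * s) * Real.exp (-(m * (2 * (t : ℝ) - 2 * (s : ℝ)))) < g (2 * t)) ∧ ∀ (n : ℕ) (ε : ℝ), 0 < ε → ∀ᶠ β : ℝ in Filter.atTop, ∀ μ ∈ Literature.MathematicalPhysics.QuantumLattice.infiniteVolumeLimitPoints (d := 4) r.ρ β, |(∫ U, φ (β * ((r.N : ℝ) - Literature.MathematicalPhysics.QuantumLattice.plaquetteObs r.ρ 0 1 2 U)) * φ (β * ((r.N : ℝ) - Literature.MathematicalPhysics.QuantumLattice.plaquetteObs r.ρ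 0 1 2 (Literature.MathematicalPhysics.QuantumLattice.configShift (-(Pi.single 0 (n : ℤ))) U))) ∂μ) - (∫ U, φ (β * ((r.N : ℝ) - Literature.MathematicalPhysics.QuantumLattice.plaquetteObs r.ρ 0 1 2 U)) ∂μ) * (∫ U, φ (β * ((r.N : ℝ) - Literature.MathematicalPhysics.QuantumLattice.plaquetteObs r.ρ 0 1 2 (Literature.MathematicalPhysics.QuantumLattice.configShift (-(Pi.single 0 (n : ℤ))) U))) ∂μ) - g n| < ε) → ∀ (β₁ : ℝ) (m : ℝ → ℝ), (∀ β : ℝ, β₁ ≤ β → 0 < m β ∧ (∃ S₀ : ℕ, ∀ A B : Literature.MathematicalPhysics.QuantumFieldTheory.YMSpecies G, ∃ C : ℝ, ∀ S n : ℕ, S₀ ≤ S → n ≤ S → |Literature.MathematicalPhysics.QuantumFieldTheory.latticeConnectedCorr r.ρ β (2 * S + 1) A.F B.F n| ≤ C * Real.exp (-(m β * n)))) → ∀ m₀ : ℝ, 0 < m₀ → ∀ᶠ β : ℝ in Filter.atTop, m β < m₀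

/-- item stmt-QuantumFields-8764 · support · rank 9 · closed · proved by Summit.QuantumFields.YangMills.Theorems.logConvexContraction_proof @ d59b5b778e08 (prover) · by planner
sources: GlimmJaffe1987, SeilerLNP1982
[support] a non-negative log-convex sequence (a_(n+1)² ≤ a_n a_(n+2)) dominated by C e^(−mn), m > 0,
contracts stepwise: a_(n+1) ≤ e^(−m) a_n for all n (ratios a_(k+1)/a_k are non-decreasing once
positive; a ratio above e^(−m) would beat the exponential bound). The sequence lemma behind "a
uniform gap bounds the effective mass at every separation". [difficulty: provable-now] -/
@[route_item "route-QuantumFields-EquipartitionCriticality"]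
def LogConvexContraction : Prop :=
  ∀ (a : ℕ → ℝ) (C m : ℝ), 0 < m → (∀ n, 0 ≤ a n) → (∀ n, a (n + 1) ^ 2 ≤ a n * a (n + 2)) → (∀ n, a n ≤ C * Real.exp (-(m * n))) → ∀ n, a (n + 1) ≤ Real.exp (-m) * a n

/-- item stmt-QuantumFields-8765 · support · rank 9 · closed · proved by Summit.QuantumFields.YangMills.Theorems.subgradientLogSqueeze_proof (prover) · by planner
sources: Ruelle1969, Griffiths1966, Georgii2011
[support] if f(β) + c log β → K as β → ∞ then every subgradient p of f at β (f(y) ≥ f(β) + p(y − β)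
for all y > 0) satisfies |β p + c| ≤ ε eventually in β, uniformly in p (difference quotients over
[β, λβ] and [β/λ, β], λ ↓ 1). With Griffiths' lemma (torus-limit energy densities are subgradients
of the convex pressure) this is the equipartition step β·E_μ[action per site] → 3D/2 of
EquipartitionPinsProbe. [difficulty: provable-now] -/
@[route_item "route-QuantumFields-EquipartitionCriticality"]
def SubgradientLogSqueeze : Prop :=
  ∀ (f : ℝ → ℝ) (c K : ℝ), Filter.Tendsto (fun β : ℝ => f β + c * Real.log β) Filter.atTop (nhds K) → ∀ ε : ℝ, 0 < ε → ∀ᶠ β : ℝ in Filter.atTop, ∀ p : ℝ, (∀ y : ℝ, 0 < y → f β + p * (y - β) ≤ f y) → |β * p + c| ≤ ε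

/-- item stmt-QuantumFields-8766 · assembly · rank 1 · closed · proved by Summit.QuantumFields.YangMills.Theorems.equipartitionCriticality_assembly_proof @ 73e5626f030a (prover) · by planner
sources: JaffeWitten2000, arXiv180301950
[assembly] FreeEnergyLogCoefficient → EquipartitionPinsProbe → RPProbeCriticality →
LatticeGapLargeBeta → CriticalContinuumLimit → YangMills. -/
@[route_item "route-QuantumFields-EquipartitionCriticality"]
def Assembly : Prop :=
  FreeEnergyLogCoefficient → EquipartitionPinsProbe → RPProbeCriticality → LatticeGapLargeBeta → CriticalContinuumLimit → YangMills

/-! D-0027 §2.1 — DECIDING THEOREM (planner-authored via `route open/edit --closes-file`; by planner-rrepair-QuantumFields-EquipartitionCri-820e560b-0 2026-08-16T17:42:47Z):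
its hypotheses are this route's items and its conclusion the sub-problem Statement (glue_lint), and it elaborates with this file. -/

/-- ROUTE GLUE (D-0027 §2.1), PURE LOGIC — re-elaborated 2026-08-16 after the statement re-type
p116790 (`def YangMills` gained the first conjunct `sch.HasWeakCouplingLimit`): fix a compact simple
`G`; `FreeEnergyLogCoefficient` gives the log-β coefficient for every faithful `r`,
`EquipartitionPinsProbe` turns it into the β → ∞ probe-covariance limit, `RPProbeCriticality` turns
that into criticality (every admissible volume-uniform clustering rate tends to `0`),
`LatticeGapLargeBeta` gives the volume-uniform gap at all large β, and the restated scope crux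
`CriticalContinuumLimit` consumes gap + criticality and returns the `G`-clause of `YangMills`
verbatim — its witness scheme now carries `sch.HasWeakCouplingLimit` (`β_k → ∞`: the route's own
`a_k := m(β_k)/Δ` construction at the `β = ∞` critical point), so no extra hypothesis is needed. -/
@[closes "route-QuantumFields-EquipartitionCriticality"] theorem closes (h2 : FreeEnergyLogCoefficient) (h3 : EquipartitionPinsProbe)
    (h9 : RPProbeCriticality) (h4 : LatticeGapLargeBeta) (h5 : CriticalContinuumLimit) :
    YangMills := by
  intro G _ _ _ _ hG
  exact h5 G hG (fun r => h4 G hG r) (fun r => h9 G hG r (h3 G hG r (h2 G hG r)))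

end Summit.QuantumFields.YangMills.Theses.EquipartitionCriticality
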